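import Summits.AtomisticToContinuum.Crystallization.Theses.FluxTubeKepler

/-!
# Sketch — crux-ideate stmt-AtomisticToContinuum-15221 (`FluxCellKepler`), ideator k = 2, round 1

First lemmas of the two idea cards, typed over existing declarations:

* card `single-scale-collapse`: `LayeredGood` (the crux's defect predicate, verbatim), `KeplerAt`
  (KEPLER at ONE pattern scale `R₀`), `WeakGluing` (potential-free local-to-global lemma for the
  layered family, counting form with radius `2R`), `SingleScaleCollapse` (Dom ∧ KeplerAt R₀ ∧
  WeakGluing R₀ ⇒ the crux BY NAME) and the free direction `keplerMono`.
* card `flux-cell-m-potential`: `PointwiseEnvelope` (Lagarias single-centre form: a LOCAL calibrated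
  score `μ` with a global envelope `Σ μ ≤ Σ λ` and a pointwise floor `μ ≥ e(P₀) + c·1[bad]`) and the
  summation lemma `keplerAt_of_pointwiseEnvelope`.

Nothing here is proved (sorries allowed in a sketch); everything elaborates.
-/

namespace Summit.AtomisticToContinuum.Crystallization.Cruxes.FluxCellKepler.IdeateK2

open scoped BigOperators
open Literature.MathematicalPhysics.StatisticalMechanics

/-- Euclidean 3-space. -/
abbrev E3 := EuclideanSpace ℝ (Fin 3)

/-- The crux's defect predicate, verbatim: site `i` of `x` is `(R, η)`-layered-good iff its
`R`-neighbourhood (relative positions) is two-way `η`-matched with a member of the relaxed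
Barlow / layered family (spacing `a ∈ [47/50, 1]`, linear isometry `A`, Hägg word `s`, layer
heights `z` with increments in `[39a/50, 17a/20]`). -/
def LayeredGood (R η : ℝ) {N : ℕ} (x : Fin N → E3) (i : Fin N) : Prop :=
  ∃ a : ℝ, 47 / 50 ≤ a ∧ a ≤ 1 ∧ ∃ (A : E3 →ₗᵢ[ℝ] E3) (s : ℤ → ℤ) (z : ℤ → ℝ), IsHaggSeq s ∧
    (∀ m : ℤ, 39 / 50 * a ≤ z (m + 1) - z m ∧ z (m + 1) - z m ≤ 17 / 20 * a) ∧
    let S : Set E3 := {p | ∃ m k l : ℤ, p = A (((k : ℝ) • triangularVec₁ a) + ((l : ℝ) • triangularVec₂ a) + ((haggLabel s m : ℝ) • barlowOffset a) + (z m • layerNormal 1))};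
    (∀ p ∈ S, ‖p‖ ≤ R → ∃ j : Fin N, dist (x j - x i) p ≤ η) ∧
      (∀ j : Fin N, ‖x j - x i‖ ≤ R → ∃ p ∈ S, dist (x j - x i) p ≤ η)

/-- The pattern of relative positions within `R₁` of site `i` (the argument of `τ` in the crux). -/
noncomputable def pattern (R₁ : ℝ) {N : ℕ} (x : Fin N → E3) (i : Fin N) : Finset E3 :=
  (Finset.univ.filter fun j : Fin N => dist (x j) (x i) ≤ R₁).image fun j => x j - x i

/-- `δ`-separation. -/
def IsSep (δ : ℝ) {N : ℕ} (x : Fin N → E3) : Prop := ∀ i j : Fin N, i ≠ j → δ ≤ dist (x i) (x j)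

/-- (DOM) of the crux: the local tail credit dominates the true `r⁻⁶` site energies in sum. -/
def Dom (R₁ : ℝ) (τ : Finset E3 → ℝ) : Prop :=
  ∀ (N : ℕ) (x : Fin N → E3), Function.Injective x →
    ∑ i, siteEnergy (fun r => (r⁻¹) ^ 6) x i ≤ ∑ i, τ (pattern R₁ x i)

/-- The flux-cell score `λ_i = (1/24) site₁₂ − τ(pattern_i)/12` (full-range repulsion kept). -/
noncomputable def cellScore (R₁ : ℝ) (τ : Finset E3 → ℝ) {N : ℕ} (x : Fin N → E3) (i : Fin N) : ℝ :=
  (1 / 24 : ℝ) * siteEnergy (fun r => (r⁻¹) ^ 12) x i - (1 / 12 : ℝ) * τ (pattern R₁ x i)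

/-- KEPLER of the crux at ONE pattern scale `R₀` (all `δ`, all `η`). -/
def KeplerAt (R₀ : ℝ) (P₀ : PeriodicConfiguration 3) (R₁ : ℝ) (τ : Finset E3 → ℝ) : Prop :=
  ∀ δ : ℝ, 0 < δ → ∀ η : ℝ, 0 < η → ∃ c : ℝ, 0 < c ∧
    ∀ (N : ℕ) (x : Fin N → E3), Function.Injective x → IsSep δ x →
      c * (Nat.card {i : Fin N // ¬ LayeredGood R₀ η x i} : ℝ)
        ≤ ∑ i, cellScore R₁ τ x i - (N : ℝ) * P₀.energyPerParticle lennardJones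

/-- KEPLER of the crux at all scales (the crux's second conjunct, with `LayeredGood` folded). -/
def KeplerAll (P₀ : PeriodicConfiguration 3) (R₁ : ℝ) (τ : Finset E3 → ℝ) : Prop :=
  ∀ δ : ℝ, 0 < δ → ∀ R η : ℝ, 0 < R → 0 < η → ∃ c : ℝ, 0 < c ∧
    ∀ (N : ℕ) (x : Fin N → E3), Function.Injective x → IsSep δ x →
      c * (Nat.card {i : Fin N // ¬ LayeredGood R η x i} : ℝ)
        ≤ ∑ i, cellScore R₁ τ x i - (N : ℝ) * P₀.energyPerParticle lennardJones

/-- **Weak gluing for the layered family** (card `single-scale-collapse`, first lemma; potential-free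
discrete geometry + compactness): for `R ≥ R₀` and every tolerance `η` there is `η' > 0` such that a
site all of whose neighbours within `3R` are `(R₀, η')`-layered-good is itself `(R, η)`-layered-good
(on `δ`-separated configurations). The exact case (`η' = 0`) is the content: local layered charts with
free Hägg words glue unless an fcc slab switches its layering normal, which forces an incoherent
junction (a non-layered site) within `√3·R + R₀ ≤ 3R`. [conjecture] -/
def WeakGluing (R₀ : ℝ) : Prop :=
  ∀ δ : ℝ, 0 < δ → ∀ R η : ℝ, R₀ ≤ R → 0 < η → ∃ η' : ℝ, 0 < η' ∧
    ∀ (N : ℕ) (x : Fin N → E3), Function.Injective x → IsSep δ x →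
      ∀ i : Fin N, (∀ j : Fin N, dist (x j) (x i) ≤ 3 * R → LayeredGood R₀ η' x j) →
        LayeredGood R η x i

/-- The free direction of the collapse: the defect predicate is monotone in the radius, so KEPLER at
scale `R ≤ R₀` follows from KEPLER at `R₀` with the same constant. [folklore] -/
theorem layeredGood_mono {R R' η : ℝ} (hR : R ≤ R') {N : ℕ} (x : Fin N → E3) (i : Fin N) :
    LayeredGood R' η x i → LayeredGood R η x i := by
  rintro ⟨a, ha₁, ha₂, A, s, z, hs, hz, h₁, h₂⟩
  refine ⟨a, ha₁, ha₂, A, s, z, hs, hz, ?_, ?_⟩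
  · intro p hp hpR
    exact h₁ p hp (hpR.trans hR)
  · intro j hj
    exact h₂ j (hj.trans hR)

/-- **Single-scale collapse** (card `single-scale-collapse`): KEPLER at one scale `R₀` plus weak
gluing gives KEPLER at every scale — for `R ≤ R₀` by `layeredGood_mono`, for `R > R₀` because every
`(R, η)`-bad site has an `(R₀, η')`-bad site within `3R`, so `#bad_R ≤ M(δ, R)·#bad_{R₀}` with
`M` the maximal number of `δ`-separated points in a `3R`-ball; `c_R := c_{R₀}(η')/M`. [folklore] -/
theorem keplerAll_of_keplerAt {R₀ : ℝ} (hR₀ : 0 < R₀) (hglue : WeakGluing R₀)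
    (P₀ : PeriodicConfiguration 3) (R₁ : ℝ) (τ : Finset E3 → ℝ) :
    KeplerAt R₀ P₀ R₁ τ → KeplerAll P₀ R₁ τ := by
  sorry

/-- … and with DOM this is the crux by name. [folklore] -/
theorem fluxCellKepler_of_singleScale {R₀ : ℝ} (hR₀ : 0 < R₀) (hglue : WeakGluing R₀)
    (P₀ : PeriodicConfiguration 3) (R₁ : ℝ) (τ : Finset E3 → ℝ)
    (hdom : Dom R₁ τ) (hkep : KeplerAt R₀ P₀ R₁ τ) :
    Summit.AtomisticToContinuum.Crystallization.Theses.FluxTubeKepler.FluxCellKepler := by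
  have hall : KeplerAll P₀ R₁ τ := keplerAll_of_keplerAt hR₀ hglue P₀ R₁ τ hkep
  refine ⟨P₀, R₁, τ, hdom, ?_⟩
  intro δ hδ R η hR hη
  obtain ⟨c, hc, hcb⟩ := hall δ hδ R η hR hη
  refine ⟨c, hc, ?_⟩
  intro N x hx hsep
  simpa [cellScore, pattern, LayeredGood] using hcb N x hx hsep

/-- **Pointwise envelope form** (card `flux-cell-m-potential`, Lagarias single-centre shape): a
LOCAL calibrated score `μ` of range `R₂ ≥ R₀` (the cell score plus a zero-sum transfer, written
directly as a function of the `R₂`-pattern) that (i) is a global lower envelope of the cell-score sum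
— `Σ_i μ(pattern_i) ≤ Σ_i λ_i` on every finite configuration (far repulsion beyond `R₂` is `≥ 0` and
may be dropped pointwise; fitted-continuation repulsion is re-credited through this envelope) — and
(ii) is bounded below POINTWISE by `e(P₀)` plus a margin `c(δ, η)` at `(R₀, η)`-bad sites. With
`e(P₀) = e*` forced, (ii) at `(R₀, η)`-good sites is the m-potential (calibration) property of the
cell score: second-order germ = SOS/Gram factorisation of the phonon form of `Σ λ`. [conjecture] -/
def PointwiseEnvelope (R₀ : ℝ) (P₀ : PeriodicConfiguration 3) (R₁ : ℝ) (τ : Finset E3 → ℝ) : Prop :=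
  ∃ (R₂ : ℝ) (μ : Finset E3 → ℝ), R₀ ≤ R₂ ∧
    (∀ (N : ℕ) (x : Fin N → E3), Function.Injective x →
      ∑ i, μ (pattern R₂ x i) ≤ ∑ i, cellScore R₁ τ x i) ∧
    (∀ δ : ℝ, 0 < δ → ∀ η : ℝ, 0 < η → ∃ c : ℝ, 0 < c ∧
      ∀ (N : ℕ) (x : Fin N → E3), Function.Injective x → IsSep δ x → ∀ i : Fin N,
        (P₀.energyPerParticle lennardJones ≤ μ (pattern R₂ x i)) ∧
          (¬ LayeredGood R₀ η x i → P₀.energyPerParticle lennardJones + c ≤ μ (pattern R₂ x i)))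

/-- Summation lemma: the pointwise envelope form gives KEPLER at scale `R₀` (sum (ii) over `i`,
`Σ_i 1[bad] = #bad`, then (i)). [folklore] -/
theorem keplerAt_of_pointwiseEnvelope (R₀ : ℝ) (P₀ : PeriodicConfiguration 3) (R₁ : ℝ)
    (τ : Finset E3 → ℝ) : PointwiseEnvelope R₀ P₀ R₁ τ → KeplerAt R₀ P₀ R₁ τ := by
  sorry

end Summit.AtomisticToContinuum.Crystallization.Cruxes.FluxCellKepler.IdeateK2
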